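import Mathlib
import Literature.NumberTheory.LFunctions.Zhang2022.SkeletonPartOneB
import HarnessLib

/-!
# Zhang (2022) toolkit: Lemma 5.6 for the product character `χθ̄` (the `p`-sum of §14 (14.8))

Topic `Literature/NumberTheory/LFunctions/Zhang2022` (Landau–Siegel audit tree; verdict-neutral).
Y. Zhang, *Discrete mean estimates and the Landau–Siegel zero*, arXiv:2211.02515v1 (2022)
[Zhang2022LandauSiegel] — **an unrefereed manuscript under adjudication**; this file is a
Zhang-normalised ADAPTER (ZHANG-L lane, START-HERE §5 (ii), ruling R-01) over a THEOREM of the tree.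
Nothing here asserts or denies Theorems 1–2 of the manuscript.

Lemma 5.6 (§5 p. 26, tex L1579; a theorem of the tree, `Skeleton.lemma56_holds`, via
`Section5PrimeSums` / `Section5Lemma56Printed`) bounds `Σ_{p∼P} θ(p)p^{1+it}` for a PRIMITIVE
character `θ (mod r)`, `1 < r < T`, `θ ≠ χ`. In §14 the lemma is invoked (p. 79, tex L3960–3962:
"for `1 < r < D³` we use the Mellin transform, Lemma 5.4 (i) and Lemma 5.6") for the `p`-sum of
(14.7)/(14.8), which carries the PRODUCT `χθ̄(p) = χ(p)θ̄(p)` of the real primitive `χ (mod D)`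
and a primitive `θ (mod r)` (typed: the factor `Σ_{p∼P} χ(p)θ⁻¹(p)Δ(l/(phr))` of
`Typed.Sec14.rhs1417On`, legs `Typed.Sec14.Eq148leg1` / `DedEq146`). The product, as a character
to the modulus `Dr`, is in general NOT primitive, so Lemma 5.6 does not apply verbatim; this file
supplies the reduction:

* `changeLevel_mul_inv_apply_natCast` — `(χ'θ'⁻¹)(a) = χ(a)θ̄(a)` for `(a, Dr) = 1`
  (`χ', θ'` the lifts to modulus `Dr`);
* `primitiveCharacter_apply_natCast` — a character and its primitive inducer agree at `a`
  coprime to the level;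
* `one_lt_conductor_mul_inv`, `conductor_mul_inv_le` — the conductor `f` of `χ'θ'⁻¹` has
  `1 < f ≤ Dr` when `θ' ≠ χ'`;
* `primitiveCharacter_mul_inv_ne_chi` — the primitive inducer of `χ'θ'⁻¹` is `≠ χ` (as characters
  mod `Df`) when `θ` is primitive to a modulus `r > 1` (else `θ̄` would be trivial on the units);
* `lemma56_chi_mul_inv` — **Lemma 5.6 for `χθ̄`**: under (A), for `D` large, `1 < r`, `Dr < T`,
  `θ` primitive mod `r`, `θ ≠ χ` (mod `Dr`), `|t| ≤ D`:
  `‖Σ_{p∼P} χ(p)θ⁻¹(p)p^{1+it}‖ ≤ C·𝔓·exp(−𝓛^{9/2})` — every `p ∼ P` exceeds `P ≥ T > Dr`, so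
  `χ(p)θ̄(p) = η₀(p)` for the primitive inducer `η₀ (mod f)` of `χ'θ'⁻¹`, and `lemma56_holds`
  applies to `η₀` (`1 < f ≤ Dr < T`, `η₀ ≠ χ`);
* `lemma56_chi_mul` — the same with `θ(p)` in place of `θ̄(p)` (`θ⁻¹` is primitive with `θ`, and
  `χ̄ = χ` for the real `χ`).

Theorems only: 0 definitions, 0 new facts, no kit. Mathlib API used: `DirichletCharacter.changeLevel`,
`conductor`, `primitiveCharacter`, `changeLevel_primitiveCharacter`, `conductor_changeLevel`,
`ZMod.unitsMap_surjective`.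

## References

* Y. Zhang, arXiv:2211.02515v1 (2022), §5 Lemma 5.6 p. 26 (tex L1579); §14 (14.7)–(14.8) and the
  proof sentence p. 79 (tex L3945–L3963); §7 (7.14) p. 38. [cite: Zhang2022LandauSiegel, §5 Lemma 5.6; §14 (14.8)]
* H. L. Montgomery, R. C. Vaughan, *Multiplicative Number Theory I* (2007), §9.1 (induced modulus,
  primitive characters). [cite: MontgomeryVaughan2007, §9.1]
-/

noncomputable section

open Complex

namespace Literature.NumberTheory.LFunctions.Zhang2022.Skeleton

open DirichletCharacter

/-! ## Character algebra: the product `χ'·θ'⁻¹ (mod Dr)` and its primitive inducer -/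

section CharacterAlgebra

variable {D r : ℕ} [NeZero D] [NeZero r] (χ : DirichletCharacter ℂ D) (θ : DirichletCharacter ℂ r)

omit [NeZero D] [NeZero r] in
/-- **Evaluation of the product of the lifts.** For `a` coprime to `Dr`,
`(χ'·θ'⁻¹)(a) = χ(a)·θ̄(a)`, where `χ' = changeLevel χ`, `θ' = changeLevel θ` are the lifts of
`χ (mod D)`, `θ (mod r)` to the modulus `Dr` and `θ̄ = θ⁻¹` (an induced character agrees with
the inducing one at arguments coprime to the modulus). [cite: MontgomeryVaughan2007, §9.1] -/
theorem changeLevel_mul_inv_apply_natCast {a : ℕ} (ha : a.Coprime (D * r)) :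
    (changeLevel (Nat.dvd_mul_right D r) χ * (changeLevel (Nat.dvd_mul_left r D) θ)⁻¹)
        (a : ZMod (D * r)) = χ (a : ZMod D) * θ⁻¹ (a : ZMod r) := by
  rw [MulChar.mul_apply, ← map_inv, ← ZMod.coe_unitOfCoprime a ha,
    changeLevel_eq_cast_of_dvd, changeLevel_eq_cast_of_dvd, ZMod.coe_unitOfCoprime,
    ZMod.cast_natCast (Nat.dvd_mul_right D r), ZMod.cast_natCast (Nat.dvd_mul_left r D)]

/-- **A character and its primitive inducer agree at arguments coprime to the level**
(Mathlib's `primitiveCharacter_apply_of_isCoprime`, at a natural number).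
[cite: MontgomeryVaughan2007, §9.1] -/
theorem primitiveCharacter_apply_natCast {n : ℕ} (ψ : DirichletCharacter ℂ n) {a : ℕ}
    (ha : a.Coprime n) : ψ.primitiveCharacter (a : ZMod ψ.conductor) = ψ (a : ZMod n) := by
  have h := primitiveCharacter_apply_of_isCoprime ψ (a := (a : ℤ)) (Nat.isCoprime_iff_coprime.mpr ha)
  simpa only [Int.cast_natCast] using h

omit [NeZero D] [NeZero r] in
/-- **The product of the lifts is non-principal** when the lifts differ: `χ'·θ'⁻¹ ≠ 1`.
[cite: MontgomeryVaughan2007, §9.1] -/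
theorem changeLevel_mul_inv_ne_one
    (hne : changeLevel (Nat.dvd_mul_left r D) θ ≠ changeLevel (Nat.dvd_mul_right D r) χ) :
    changeLevel (Nat.dvd_mul_right D r) χ * (changeLevel (Nat.dvd_mul_left r D) θ)⁻¹ ≠ 1 := by
  intro h
  exact hne (mul_inv_eq_one.mp h).symm

/-- **The conductor of `χ'·θ'⁻¹` exceeds `1`** when the lifts differ (a non-principal character
to a non-zero modulus has conductor `> 1`). [cite: MontgomeryVaughan2007, §9.1] -/
theorem one_lt_conductor_mul_inv
    (hne : changeLevel (Nat.dvd_mul_left r D) θ ≠ changeLevel (Nat.dvd_mul_right D r) χ) :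
    1 < (changeLevel (Nat.dvd_mul_right D r) χ *
      (changeLevel (Nat.dvd_mul_left r D) θ)⁻¹).conductor := by
  haveI : NeZero (D * r) := ⟨mul_ne_zero (NeZero.ne D) (NeZero.ne r)⟩
  have h0 := (changeLevel (Nat.dvd_mul_right D r) χ *
    (changeLevel (Nat.dvd_mul_left r D) θ)⁻¹).conductor_ne_zero
  have h1 : (changeLevel (Nat.dvd_mul_right D r) χ *
      (changeLevel (Nat.dvd_mul_left r D) θ)⁻¹).conductor ≠ 1 := fun h =>
    changeLevel_mul_inv_ne_one χ θ hne (eq_one_iff_conductor_eq_one.mpr h)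
  omega

omit [NeZero r] in
/-- **The conductor of a character to the modulus `Dr` is at most `Dr`** (it divides the
modulus). [cite: MontgomeryVaughan2007, §9.1] -/
theorem conductor_le_mul (η : DirichletCharacter ℂ (D * r)) (hr : 0 < r) :
    η.conductor ≤ D * r :=
  Nat.le_of_dvd (Nat.mul_pos (Nat.pos_of_ne_zero (NeZero.ne D)) hr) η.conductor_dvd_level

/-- **The primitive inducer of `χ'·θ'⁻¹` is not `χ`.** If `θ` is primitive to a modulus `r > 1`
and `η = χ'·θ'⁻¹ (mod Dr)` with primitive inducer `η₀ (mod f)`, then `η₀ ≠ χ` as characters to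
the modulus `Df`: otherwise `χ(a)θ̄(a) = η(a) = η₀(a) = χ(a)` for every `a` coprime to `D²r`,
so `θ̄ = 1` on the units of `ZMod r` (every unit mod `r` lifts to a unit mod `D²r`), i.e. `θ = 1`,
contradicting `cond θ = r > 1`. [cite: MontgomeryVaughan2007, §9.1] -/
theorem primitiveCharacter_mul_inv_ne_chi (hθ : θ.IsPrimitive) (hr : 1 < r)
    (η : DirichletCharacter ℂ (D * r))
    (hη : η = changeLevel (Nat.dvd_mul_right D r) χ * (changeLevel (Nat.dvd_mul_left r D) θ)⁻¹) :
    changeLevel (Nat.dvd_mul_left η.conductor D) η.primitiveCharacter ≠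
      changeLevel (Nat.dvd_mul_right D η.conductor) χ := by
  intro hEq
  haveI : NeZero (D * r) := ⟨mul_ne_zero (NeZero.ne D) (NeZero.ne r)⟩
  haveI : NeZero (D * (D * r)) := ⟨mul_ne_zero (NeZero.ne D) (NeZero.ne (D * r))⟩
  set f : ℕ := η.conductor with hf
  have hfDr : f ∣ D * r := η.conductor_dvd_level
  have hDf : D * f ∣ D * (D * r) := Nat.mul_dvd_mul_left D hfDr
  have hrN : r ∣ D * (D * r) := Dvd.dvd.mul_left (Nat.dvd_mul_left r D) D
  -- `θ⁻¹` is trivial on every unit of `ZMod r`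
  have hθinv : θ⁻¹ = 1 := by
    refine MulChar.ext fun v => ?_
    rw [MulChar.one_apply_coe]
    obtain ⟨w, hw⟩ := ZMod.unitsMap_surjective hrN v
    set a : ℕ := (w : ZMod (D * (D * r))).val with ha
    have haN : a.Coprime (D * (D * r)) := ZMod.val_coe_unit_coprime w
    have haw : (a : ZMod (D * (D * r))) = w := ZMod.natCast_zmod_val _
    have hva : (v : ZMod r) = (a : ZMod r) := by
      rw [← hw, ZMod.unitsMap_val, ← haw, ZMod.cast_natCast hrN]
    have haDr : a.Coprime (D * r) := haN.coprime_dvd_right (Nat.dvd_mul_left (D * r) D)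
    have haDf : a.Coprime (D * f) := haN.coprime_dvd_right hDf
    have haD : a.Coprime D := haN.coprime_dvd_right (Nat.dvd_mul_right D (D * r))
    -- `η(a) = χ(a)θ̄(a)` and `η₀(a) = η(a)`
    have e1 : η (a : ZMod (D * r)) = χ (a : ZMod D) * θ⁻¹ (a : ZMod r) := by
      rw [hη]; exact changeLevel_mul_inv_apply_natCast χ θ haDr
    have e2 : η.primitiveCharacter (a : ZMod f) = η (a : ZMod (D * r)) :=
      primitiveCharacter_apply_natCast η haDr
    -- `η₀(a) = χ(a)` from the assumed equality of the lifts to modulus `Df`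
    have e3 : η.primitiveCharacter (a : ZMod f) = χ (a : ZMod D) := by
      have h := DFunLike.congr_fun hEq ((ZMod.unitOfCoprime a haDf : (ZMod (D * f))ˣ) : ZMod (D * f))
      rwa [changeLevel_eq_cast_of_dvd, changeLevel_eq_cast_of_dvd, ZMod.coe_unitOfCoprime,
        ZMod.cast_natCast (Nat.dvd_mul_left f D), ZMod.cast_natCast (Nat.dvd_mul_right D f)] at h
    -- `χ(a) ≠ 0`
    have hχa : χ (a : ZMod D) ≠ 0 := by
      have h1 : ‖χ (a : ZMod D)‖ = 1 := by
        rw [← ZMod.coe_unitOfCoprime a haD]; exact χ.unit_norm_eq_one _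
      intro h0
      rw [h0, norm_zero] at h1
      exact zero_ne_one h1
    have key : χ (a : ZMod D) * θ⁻¹ (a : ZMod r) = χ (a : ZMod D) := by rw [← e1, ← e2, e3]
    rw [hva]
    exact (mul_eq_left₀ hχa).mp key
  have hθ1 : θ = 1 := inv_eq_one.mp hθinv
  have hcond : θ.conductor = 1 := eq_one_iff_conductor_eq_one.mp hθ1
  rw [isPrimitive_def] at hθ
  omega

end CharacterAlgebra

/-! ## Lemma 5.6 for `χθ̄` -/

/-- `𝓛 ≥ 1` for `D ≥ 3` (local copy). [cite: Zhang2022LandauSiegel, §2 (2.1)] -/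
private theorem one_le_ell_tk {D : ℕ} (hD : 3 ≤ D) : 1 ≤ ell D := by
  have hD' : (3 : ℝ) ≤ D := by exact_mod_cast hD
  have h : (1 : ℝ) < Real.log 3 := by
    rw [Real.lt_log_iff_exp_lt (by norm_num)]
    exact Real.exp_one_lt_d9.trans (by norm_num)
  exact le_trans h.le (Real.log_le_log (by norm_num) hD')

/-- `T ≤ P` for `D ≥ 3` (`𝓛^{1.1} ≤ 𝓛⁹` since `𝓛 ≥ 1`). [cite: Zhang2022LandauSiegel, §2 (2.6), §6 p.28] -/
theorem bigT_le_bigP {D : ℕ} (hD : 3 ≤ D) : bigT D ≤ bigP D := by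
  have hℓ := one_le_ell_tk hD
  rw [bigT, bigP, Real.exp_le_exp]
  calc ell D ^ (1.1 : ℝ) ≤ ell D ^ ((9 : ℕ) : ℝ) :=
        Real.rpow_le_rpow_of_exponent_le hℓ (by norm_num)
    _ = ell D ^ 9 := Real.rpow_natCast _ _

/-- A prime of the window `p ∼ P` is coprime to every `0 < n < T` (indeed `n < T ≤ P < p`).
[cite: Zhang2022LandauSiegel, §2 p.4] -/
theorem coprime_of_mem_primeWindow_of_lt_bigT {D p n : ℕ} (hD : 3 ≤ D) (hp : p ∈ primeWindow D)
    (hn0 : 0 < n) (hn : (n : ℝ) < bigT D) : p.Coprime n := by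
  obtain ⟨hpI, hpp⟩ := Finset.mem_filter.mp hp
  have hPp : bigP D < p := (Nat.floor_lt (Real.exp_pos _).le).mp (Finset.mem_Ioo.mp hpI).1
  have hnp : n < p := by
    have : (n : ℝ) < p := hn.trans_le ((bigT_le_bigP hD).trans hPp.le)
    exact_mod_cast this
  refine (Nat.Prime.coprime_iff_not_dvd hpp).mpr fun hdvd => ?_
  exact absurd (Nat.le_of_dvd hn0 hdvd) (not_le.mpr hnp)

/-- **Lemma 5.6 for the product character `χθ̄`** (the `p`-sum of §14 (14.7)/(14.8), p. 79:
"for `1 < r < D³` we use … Lemma 5.6"). Under (A), for `D` large: for every `1 < r` with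
`Dr < T`, every primitive `θ (mod r)` with `θ ≠ χ` (as characters mod `Dr`) and every `|t| ≤ D`,
`‖Σ_{p∼P} χ(p)θ̄(p)p^{1+it}‖ ≤ C·𝔓·exp(−𝓛^{9/2})`. Proof: each `p ∼ P` has `p > P ≥ T > Dr`, so
`χ(p)θ̄(p) = η₀(p)` for the primitive inducer `η₀ (mod f)` of `χ'θ'⁻¹ (mod Dr)`, and Lemma 5.6
(`lemma56_holds`) applies to `η₀`: `1 < f ≤ Dr < T`, `η₀ ≠ χ` (`primitiveCharacter_mul_inv_ne_chi`).
[cite: Zhang2022LandauSiegel, §5 Lemma 5.6 p.26; §14 (14.8) p.79, tex L3960] -/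
theorem lemma56_chi_mul_inv :
    ∃ C : ℝ, ForAllLarge fun D _ χ => AssumptionA D χ →
      ∀ (r : ℕ) [NeZero r], 1 < r → (D : ℝ) * r < bigT D →
        ∀ θ : DirichletCharacter ℂ r, θ.IsPrimitive →
          changeLevel (Nat.dvd_mul_left r D) θ ≠ changeLevel (Nat.dvd_mul_right D r) χ →
          ∀ t : ℝ, |t| ≤ D →
            ‖∑ p ∈ primeWindow D, χ (p : ZMod D) * θ⁻¹ (p : ZMod r) * (p : ℂ) ^ (1 + t * I)‖ ≤
              C * frakP D * Real.exp (-(ell D ^ ((9 : ℝ) / 2))) := by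
  obtain ⟨C, D₀, h56⟩ := lemma56_holds
  refine ⟨C, max D₀ 3, fun D _ χ hD hq hp hA r _ hr hrT θ hθ hne t ht => ?_⟩
  have hD₀ : D₀ ≤ D := le_trans (le_max_left _ _) hD
  have hD3 : 3 ≤ D := le_trans (le_max_right _ _) hD
  haveI : NeZero (D * r) := ⟨mul_ne_zero (NeZero.ne D) (NeZero.ne r)⟩
  set η : DirichletCharacter ℂ (D * r) :=
    changeLevel (Nat.dvd_mul_right D r) χ * (changeLevel (Nat.dvd_mul_left r D) θ)⁻¹ with hη
  haveI : NeZero η.conductor := ⟨η.conductor_ne_zero⟩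
  have h1f : 1 < η.conductor := by rw [hη]; exact one_lt_conductor_mul_inv χ θ hne
  have hfDr : η.conductor ≤ D * r := conductor_le_mul η (by omega)
  have hDrT : ((D * r : ℕ) : ℝ) < bigT D := by push_cast; exact hrT
  have hfT : (η.conductor : ℝ) < bigT D := lt_of_le_of_lt (Nat.cast_le.mpr hfDr) hDrT
  have hne' := primitiveCharacter_mul_inv_ne_chi χ θ hθ hr η hη
  have hsum : ∑ p ∈ primeWindow D, χ (p : ZMod D) * θ⁻¹ (p : ZMod r) * (p : ℂ) ^ (1 + t * I) =
      ∑ p ∈ primeWindow D, η.primitiveCharacter (p : ZMod η.conductor) * (p : ℂ) ^ (1 + t * I) := by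
    refine Finset.sum_congr rfl fun p hpw => ?_
    have hcop : p.Coprime (D * r) :=
      coprime_of_mem_primeWindow_of_lt_bigT hD3 hpw (Nat.pos_of_ne_zero (NeZero.ne (D * r))) hDrT
    rw [primitiveCharacter_apply_natCast η hcop, hη, changeLevel_mul_inv_apply_natCast χ θ hcop]
  rw [hsum]
  exact h56 D χ hD₀ hq hp hA η.conductor h1f hfT η.primitiveCharacter
    η.primitiveCharacter_isPrimitive hne' t ht

/-- **Lemma 5.6 for `χθ`** (the same bound with `θ(p)` in place of `θ̄(p)`): `θ⁻¹` is primitive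
with `θ`, `θ⁻¹⁻¹ = θ`, and for the real `χ` the side condition `θ̄ ≠ χ` is `θ ≠ χ̄ = χ`.
[cite: Zhang2022LandauSiegel, §5 Lemma 5.6 p.26; §14 (14.8) p.79] -/
theorem lemma56_chi_mul :
    ∃ C : ℝ, ForAllLarge fun D _ χ => AssumptionA D χ →
      ∀ (r : ℕ) [NeZero r], 1 < r → (D : ℝ) * r < bigT D →
        ∀ θ : DirichletCharacter ℂ r, θ.IsPrimitive →
          changeLevel (Nat.dvd_mul_left r D) θ ≠ changeLevel (Nat.dvd_mul_right D r) χ →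
          ∀ t : ℝ, |t| ≤ D →
            ‖∑ p ∈ primeWindow D, χ (p : ZMod D) * θ (p : ZMod r) * (p : ℂ) ^ (1 + t * I)‖ ≤
              C * frakP D * Real.exp (-(ell D ^ ((9 : ℝ) / 2))) := by
  obtain ⟨C, D₀, h⟩ := lemma56_chi_mul_inv
  refine ⟨C, D₀, fun D _ χ hD hq hp hA r _ hr hrT θ hθ hne t ht => ?_⟩
  haveI : NeZero (D * r) := ⟨mul_ne_zero (NeZero.ne D) (NeZero.ne r)⟩
  have hθ' : θ⁻¹.IsPrimitive := by
    rw [isPrimitive_def, conductor_inv]; exact hθ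
  have hne' : changeLevel (Nat.dvd_mul_left r D) θ⁻¹ ≠ changeLevel (Nat.dvd_mul_right D r) χ := by
    intro h'
    apply hne
    have h2 := congrArg (fun ψ : DirichletCharacter ℂ (D * r) => ψ⁻¹) h'
    simp only [map_inv, inv_inv] at h2
    rw [h2, ← map_inv, MulChar.IsQuadratic.inv hq]
  have := h D χ hD hq hp hA r hr hrT θ⁻¹ hθ' hne' t ht
  simpa only [inv_inv] using this

end Literature.NumberTheory.LFunctions.Zhang2022.Skeleton
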